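/-
Origin: expansion seat `planner-pub-hodgecm-pv09-g4-0`, handover #17 2026-08-18T08:21:49Z (`HOME/pub-hodgecm-pv09-g4/lean/Pv09g4/LocTorusClosed.lean`, md5 945c3b0b, 102 lines);
landed by the gen-7 packager in gate run 26 as `HodgeCM/PerL34/LocTorusClosed.lean` (import ^import Pv[0-9]+g[0-9]+\.→import HodgeCM.PerL34. ×1).
-/
/-
HodgeCM / PerL34 publication cell — seam S3 set-up, model side (pub-hodgecm-pv09-g4, HANDOVER #17).
WIP import: `Pv09g4.IdelicTorusModel` ↦ `HodgeCM.PerL34.IdelicTorusModel`; `HodgeCM.PerL34.PureTensorChar` is tree.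
Complete proofs, no new axioms, nothing cited.
-/
import Summits.HodgeConjecture.HodgeCM.PerL34.IdelicTorusModel
import Summits.HodgeConjecture.HodgeCM.PerL34.PureTensorChar_2

/-!
# The local groups `locTorus K L v` are CLOSED: extension by one

`extOne K L v z` := the idele whose `v`-block is `z` and whose other coordinates are `1` (Mathlib
`RestrictedProduct.mulSingle` through `Φ⁻¹`).  By the block-by-block membership criterion of #14,
`z ∈ locTorus K L v ↔ extOne v z ∈ U(1)_{L/K}(𝔸_K)` (`mem_locTorus_iff_extOne_mem`), so `locTorus v` is the
preimage of pv11-g4's CLOSED torus under a continuous map: `isClosed_locTorus` (per-place item (d4) of GAPS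
pv09g4-A6; it is what makes `locTorus v` locally compact once `Π_{w ∣ v} L_wˣ` is).
-/

set_option autoImplicit false

noncomputable section

open Topology Filter Set NumberField
open scoped RestrictedProduct

namespace HodgeCM.PerL34.IdelicTorusModel

open IdelePlaces RestrictedRegroup RestrictedCutout

variable (K L : Type) [Field K] [Field L] [Algebra K L] [NumberField K] [NumberField L]
  [DecidableEq (Place K)]

/-- **Extension by one**: the idele with `v`-block `z` and all other local coordinates `1`. -/
def extOne (k : Place K) (z : FibGroup K L k) : ideleGroup L :=
  (Φ K L).symm (RestrictedProduct.mulSingle (fun k => fibSubgroup (intUnits L) (pl K L) k) k z)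

/-- (Ported verbatim from the HodgeCMPerL package; no docstring in the source.) -/
theorem proj_extOne_same (k : Place K) (z : FibGroup K L k) : proj K L k (extOne K L k z) = z := by
  change (Φ K L ((Φ K L).symm _)) k = z
  rw [ContinuousMulEquiv.apply_symm_apply, RestrictedProduct.mulSingle_eq_same]

/-- (Ported verbatim from the HodgeCMPerL package; no docstring in the source.) -/
theorem proj_extOne_of_ne {k k' : Place K} (h : k' ≠ k) (z : FibGroup K L k) :
    proj K L k' (extOne K L k z) = 1 := by
  change (Φ K L ((Φ K L).symm _)) k' = 1
  rw [ContinuousMulEquiv.apply_symm_apply, RestrictedProduct.mulSingle_eq_of_ne _ z h]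

/-- (Ported verbatim from the HodgeCMPerL package; no docstring in the source.) -/
theorem continuous_extOne (k : Place K) : Continuous (extOne K L k) :=
  (Φ K L).symm.continuous.comp (PureTensor.continuous_mulSingle _ k)

variable [FiniteDimensional K L]

/-- **`z ∈ U_v ↔ (z at v, 1 elsewhere) ∈ U(1)_{L/K}(𝔸_K)`.** -/
theorem mem_locTorus_iff_extOne_mem (k : Place K) (z : FibGroup K L k) :
    z ∈ locTorus K L k ↔ extOne K L k z ∈ relNormOneIdeles K L := by
  constructor
  · rintro ⟨t, ht, rfl⟩
    rw [mem_relNormOneIdeles_iff_forall_proj_mem]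
    intro k'
    by_cases hk : k' = k
    · subst hk
      rw [proj_extOne_same]
      exact proj_mem_locTorus K L ht k'
    · rw [proj_extOne_of_ne K L hk]
      exact one_mem _
  · intro h
    exact ⟨_, h, proj_extOne_same K L k z⟩

/-- `U_v` is the preimage of the torus under extension by one. -/
theorem coe_locTorus_eq_preimage (k : Place K) :
    (locTorus K L k : Set (FibGroup K L k)) = extOne K L k ⁻¹' (relNormOneIdeles K L : Set (ideleGroup L)) :=
  Set.ext fun z => mem_locTorus_iff_extOne_mem K L k z

/-- **The local groups are closed** in `Π_{w ∣ v} L_wˣ`. -/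
theorem isClosed_locTorus (k : Place K) : IsClosed (locTorus K L k : Set (FibGroup K L k)) := by
  rw [coe_locTorus_eq_preimage]
  exact (isClosed_relNormOneIdeles K L).preimage (continuous_extOne K L k)

/-! ## Separation and local compactness of the local groups -/

/-- `L_wˣ` is Hausdorff (both kinds of places). -/
instance instT2SpaceLocUnits : ∀ i : Place L, T2Space (LocUnits L i)
  | .inl w => inferInstanceAs (T2Space (w.Completion)ˣ)
  | .inr v => inferInstanceAs (T2Space (v.adicCompletion L)ˣ)

/-- `L_wˣ` is locally compact (both kinds of places; Mathlib: completions of a number field are locally compact). -/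
instance instLocallyCompactSpaceLocUnits : ∀ i : Place L, LocallyCompactSpace (LocUnits L i)
  | .inl w => inferInstanceAs (LocallyCompactSpace (w.Completion)ˣ)
  | .inr v => inferInstanceAs (LocallyCompactSpace (v.adicCompletion L)ˣ)

/-- The fibres of `pl` are finite (instance form of #14 `tendsto_pl`). -/
instance finite_fib_pl (k : Place K) : Finite (Fib (pl K L) k) := finite_fib _ (tendsto_pl K L) k

example (k : Place K) : T2Space (FibGroup K L k) := inferInstance
example (k : Place K) : LocallyCompactSpace (FibGroup K L k) := inferInstance
example (k : Place K) : T2Space (locTorus K L k) := inferInstance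

/-- **`U_v = locTorus K L v` is locally compact** (closed in the locally compact `Π_{w ∣ v} L_wˣ`). -/
instance locallyCompactSpace_locTorus (k : Place K) : LocallyCompactSpace (locTorus K L k) :=
  (isClosed_locTorus K L k).isClosedEmbedding_subtypeVal.locallyCompactSpace

end HodgeCM.PerL34.IdelicTorusModel

end
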